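import Literature.Analysis.FluidPDE.TsaiMaximumPrinciple
import HarnessLib

/-!
# An expanding-ball barrier for the drift–heat equation `v_t + a·∇v − Δv = 0` with bounded drift

Analysis/FluidPDE support file for the discharge of the named fact
`Literature.Analysis.FluidPDE.KNSS2009_lemma21_halfball` (`FluidPDE/KNSSRegularity`: Koch–Nadirashvili–
Seregin–Šverák 2009, Lemma 2.1 — stability of the strong maximum principle — in the half-ball
form used in the proofs of their Theorems 5.1–5.2), together with the comparison principle of
`FluidPDE/DriftHeatComparison`. It provides the explicit subsolution that carries a positive
lower bound of a nonnegative solution from a small ball at time `t₁` to a ball of radius `2R` at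
times `t₁ + T₀ ≤ t ≤ t₁ + T₀ + R²` ("propagation of positivity"), uniformly over all drifts `a`
with `‖a‖ ≤ A`.

## The barrier

On a real inner product space `E` of dimension `d`, with centre `c`, initial radius `r₀ > 0`,
expansion rate `κ ≥ 0`, decay rate `l` and exponent `n + 2`:

  `φ(t, y) = m₀ e^{−l (t − t₁)} (1 − ‖y − c‖² / ρ(t)²)^(n+2)`,  `ρ(t) = r₀ + κ (t − t₁)`

(`knssBarrier`, with radius `knssRad` and radial profile `knssProfile m ρ n σ = m (1 − σ/ρ²)^(n+2)`
in the variable `σ = ‖y − c‖²`). We compute its gradient (`hasFDerivAt_knssBarrier`,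
`norm_fderiv_knssBarrier`), its Laplacian (`laplacian_knssBarrier`, from the radial calculus of
`FluidPDE/RadialCalculus`) and its time derivative (`hasDerivAt_knssBarrier_time`, recorded as the
function `knssBarrierDt`), and prove the **subsolution inequality** (`knssBarrier_subsolution`):
with `B = 2κ/r₀ + 2d/r₀² + 2A/r₀`, if `(n + 2) B ≤ l` and `B ρmax² ≤ 4 (n + 1)` then

  `φ_t − Δφ + A ‖∇φ‖ ≤ 0` wherever `t ≥ t₁`, `ρ(t) ≤ ρmax`, `‖y − c‖ ≤ ρ(t)`.

Indeed, with `u = 1 − q`, `q = ‖y − c‖²/ρ²`, the left side is `m uⁿ` times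
`−l u² + (n+2) u (2κ q/ρ + 2d/ρ² + 2A‖y − c‖/ρ²) − 4(n+2)(n+1) q/ρ²`; the middle coefficient is
`≤ B`, `u ≤ u² + q`, and `q/ρ² ≥ q/ρmax²`, so the bracket is
`≤ ((n+2)B − l) u² + (n+2) q (B − 4(n+1)/ρmax²) ≤ 0` (`knssBarrier_bracket_nonpos`). Barriers of
this "expanding paraboloid" type are the standard device behind propagation of positivity and
the strong maximum principle for parabolic equations: Lieberman 1996, Ch. II, Lemma 2.6 uses
`ψ = ψ₁² ψ₀^{−q}`, `ψ₁ = (ψ₀(t) − |x|²)₊` with `ψ₀` affine in `t`, on `{|x|² < ψ₀(t)}`; the present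
variant (power `n + 2` of `1 − |x|²/ρ(t)²`, `ρ` affine, times `e^{−lt}`) is chosen so that every
constant is elementary and the gradient term `A‖∇φ‖` of an arbitrary bounded drift is absorbed.

## References

* G. M. Lieberman, *Second order parabolic differential equations*, World Scientific 1996,
  Ch. II, Lemma 2.6 and its proof (the barrier `ψ`) [Lieberman1996].
* G. Koch, N. Nadirashvili, G. Seregin, V. Šverák, *Liouville theorems for the Navier–Stokes
  equations and applications*, Acta Math. 203 (2009) = arXiv:0709.3599, Lemma 2.1
  [KochNadirashviliSereginSverak2009].
-/

noncomputable section

open MeasureTheory Set Function Filter Topology InnerProductSpace Metric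
open scoped RealInnerProductSpace Laplacian ContDiff

namespace Literature.Analysis.FluidPDE

/-! ### Pure real-variable algebra of the barrier -/

/-- The algebraic heart of the subsolution property of the expanding-ball barrier: with
`u = 1 − σ/ρ²`, `σ = z²`, `0 ≤ z ≤ ρ`, `r₀ ≤ ρ ≤ ρmax`, `B = 2κ/r₀ + 2d/r₀² + 2A/r₀`,
`(n + 2) B ≤ l` and `B ρmax² ≤ 4 (n + 1)`, the bracket
`−l u² + (n+2) u (2κσ/ρ³ + 2d/ρ² + 2Az/ρ²) − 4(n+2)(n+1) σ/ρ⁴` is `≤ 0`. [folklore] -/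
theorem knssBarrier_bracket_nonpos {A κ r₀ d l ρ ρmax z : ℝ} (n : ℕ) (hA : 0 ≤ A)
    (hκ : 0 ≤ κ) (hr₀ : 0 < r₀) (hd : 0 ≤ d)
    (hl : (n + 2) * (2 * κ / r₀ + 2 * d / r₀ ^ 2 + 2 * A / r₀) ≤ l)
    (hn : (2 * κ / r₀ + 2 * d / r₀ ^ 2 + 2 * A / r₀) * ρmax ^ 2 ≤ 4 * (n + 1))
    (hρr : r₀ ≤ ρ) (hρmax : ρ ≤ ρmax) (hz0 : 0 ≤ z) (hzρ : z ≤ ρ) :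
    -l * (1 - z ^ 2 / ρ ^ 2) ^ 2 +
        (n + 2) * (1 - z ^ 2 / ρ ^ 2) *
          (2 * κ * z ^ 2 / ρ ^ 3 + 2 * d / ρ ^ 2 + 2 * A * z / ρ ^ 2) -
        4 * (n + 2) * (n + 1) * z ^ 2 / ρ ^ 4 ≤ 0 := by
  have hρ0 : 0 < ρ := hr₀.trans_le hρr
  have hρmax0 : 0 < ρmax := hρ0.trans_le hρmax
  obtain ⟨B, hB⟩ : ∃ B : ℝ, B = 2 * κ / r₀ + 2 * d / r₀ ^ 2 + 2 * A / r₀ := ⟨_, rfl⟩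
  rw [← hB] at hl hn
  have hB0 : 0 ≤ B := by rw [hB]; positivity
  obtain ⟨q, hq⟩ : ∃ q : ℝ, q = z ^ 2 / ρ ^ 2 := ⟨_, rfl⟩
  have hσρ : z ^ 2 ≤ ρ ^ 2 := pow_le_pow_left₀ hz0 hzρ 2
  have hq0 : 0 ≤ q := by rw [hq]; positivity
  have hq1 : q ≤ 1 := by rwa [hq, div_le_one (by positivity)]
  obtain ⟨u, hu⟩ : ∃ u : ℝ, u = 1 - z ^ 2 / ρ ^ 2 := ⟨_, rfl⟩
  have huq : u = 1 - q := by rw [hu, hq]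
  have hu0 : 0 ≤ u := by rw [huq]; linarith
  rw [← hu]
  -- bound the drift/curvature coefficients by `B`
  have hb1 : 2 * κ * z ^ 2 / ρ ^ 3 ≤ 2 * κ / r₀ := by
    rw [div_le_div_iff₀ (by positivity) hr₀]
    have h1 : z ^ 2 * r₀ ≤ ρ ^ 2 * ρ := mul_le_mul hσρ hρr hr₀.le (by positivity)
    have h2 : 2 * κ * (z ^ 2 * r₀) ≤ 2 * κ * (ρ ^ 2 * ρ) :=
      mul_le_mul_of_nonneg_left h1 (by positivity)
    calc 2 * κ * z ^ 2 * r₀ = 2 * κ * (z ^ 2 * r₀) := by ring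
      _ ≤ 2 * κ * (ρ ^ 2 * ρ) := h2
      _ = 2 * κ * ρ ^ 3 := by ring
  have hb2 : 2 * d / ρ ^ 2 ≤ 2 * d / r₀ ^ 2 :=
    div_le_div_of_nonneg_left (by positivity) (by positivity) (pow_le_pow_left₀ hr₀.le hρr 2)
  have hb3 : 2 * A * z / ρ ^ 2 ≤ 2 * A / r₀ := by
    rw [div_le_div_iff₀ (by positivity) hr₀]
    have h1 : z * r₀ ≤ ρ * ρ := mul_le_mul hzρ hρr hr₀.le hρ0.le
    have h2 : 2 * A * (z * r₀) ≤ 2 * A * (ρ * ρ) := mul_le_mul_of_nonneg_left h1 (by positivity)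
    calc 2 * A * z * r₀ = 2 * A * (z * r₀) := by ring
      _ ≤ 2 * A * (ρ * ρ) := h2
      _ = 2 * A * ρ ^ 2 := by ring
  have hbr : 2 * κ * z ^ 2 / ρ ^ 3 + 2 * d / ρ ^ 2 + 2 * A * z / ρ ^ 2 ≤ B := by
    rw [hB]; linarith
  have hpu : (n + 2 : ℝ) * u * (2 * κ * z ^ 2 / ρ ^ 3 + 2 * d / ρ ^ 2 + 2 * A * z / ρ ^ 2) ≤
      (n + 2) * u * B := mul_le_mul_of_nonneg_left hbr (by positivity)
  -- `u ≤ u² + q`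
  have hu2 : u ≤ u ^ 2 + q := by
    have : u ^ 2 + q - u = q ^ 2 := by rw [huq]; ring
    nlinarith
  have hpuB : (n + 2 : ℝ) * u * B ≤ (n + 2) * B * (u ^ 2 + q) := by
    have := mul_le_mul_of_nonneg_left hu2 (by positivity : (0 : ℝ) ≤ (n + 2) * B)
    linarith
  -- the curvature term, with `ρ ≤ ρmax`
  have hlast : 4 * (n + 2 : ℝ) * (n + 1) * q / ρmax ^ 2 ≤
      4 * (n + 2) * (n + 1) * z ^ 2 / ρ ^ 4 := by
    have e1 : 4 * (n + 2 : ℝ) * (n + 1) * z ^ 2 / ρ ^ 4 = 4 * (n + 2) * (n + 1) * q / ρ ^ 2 := by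
      rw [hq]
      field_simp
    rw [e1]
    exact div_le_div_of_nonneg_left (by positivity) (by positivity)
      (pow_le_pow_left₀ hρ0.le hρmax 2)
  have hBn : B ≤ 4 * (n + 1) / ρmax ^ 2 := by
    rw [le_div_iff₀ (by positivity)]
    exact hn
  have t1 : ((n + 2 : ℝ) * B - l) * u ^ 2 ≤ 0 :=
    mul_nonpos_of_nonpos_of_nonneg (by linarith) (by positivity)
  have t2 : (n + 2 : ℝ) * q * (B - 4 * (n + 1) / ρmax ^ 2) ≤ 0 :=
    mul_nonpos_of_nonneg_of_nonpos (by positivity) (by linarith)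
  have e : ((n + 2 : ℝ) * B - l) * u ^ 2 + (n + 2) * q * (B - 4 * (n + 1) / ρmax ^ 2) =
      -l * u ^ 2 + (n + 2) * B * (u ^ 2 + q) - 4 * (n + 2) * (n + 1) * q / ρmax ^ 2 := by ring
  nlinarith

section Barrier

variable {E : Type*} [NormedAddCommGroup E] [InnerProductSpace ℝ E]

/-- Radius `ρ(t) = r₀ + κ (t − t₁)` of the expanding ball carrying the barrier. [folklore] -/
def knssRad (r₀ κ t₁ t : ℝ) : ℝ := r₀ + κ * (t - t₁)

/-- The radial profile `σ ↦ m (1 − σ/ρ²)^(n+2)` of the barrier, in the variable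
`σ = ‖y − c‖²`. [folklore] -/
def knssProfile (m ρ : ℝ) (n : ℕ) (σ : ℝ) : ℝ := m * (1 - σ / ρ ^ 2) ^ (n + 2)

/-- First derivative of `knssProfile m ρ n`. [folklore] -/
def knssProfile₁ (m ρ : ℝ) (n : ℕ) (σ : ℝ) : ℝ :=
  -(m * (n + 2) / ρ ^ 2) * (1 - σ / ρ ^ 2) ^ (n + 1)

/-- Second derivative of `knssProfile m ρ n`. [folklore] -/
def knssProfile₂ (m ρ : ℝ) (n : ℕ) (σ : ℝ) : ℝ :=
  (m * (n + 2) * (n + 1) / ρ ^ 4) * (1 - σ / ρ ^ 2) ^ n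

/-- The radial function `w ↦ m (1 − ‖w‖²/ρ²)^(n+2)`. [folklore] -/
def knssRadial (m ρ : ℝ) (n : ℕ) (w : E) : ℝ := knssProfile m ρ n (‖w‖ ^ 2)

/-- The expanding-ball barrier `φ(t, y) = m₀ e^{−l (t − t₁)} (1 − ‖y − c‖²/ρ(t)²)^(n+2)`,
`ρ(t) = r₀ + κ(t − t₁)` (a subsolution of `φ_t − Δφ + A‖∇φ‖ ≤ 0` on `‖y − c‖ < ρ(t)` for
suitable `l, n`, see `knssBarrier_subsolution`; a variant of the barrier `ψ = ψ₁²ψ₀^{−q}` of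
Lieberman 1996, Ch. II, proof of Lemma 2.6). [cite: Lieberman1996, Ch. II Lemma 2.6 (proof; variant)] -/
def knssBarrier (c : E) (m₀ l r₀ κ t₁ : ℝ) (n : ℕ) (t : ℝ) (y : E) : ℝ :=
  knssProfile (m₀ * Real.exp (-l * (t - t₁))) (knssRad r₀ κ t₁ t) n (‖y - c‖ ^ 2)

/-- The time derivative of `knssBarrier`. [folklore] -/
def knssBarrierDt (c : E) (m₀ l r₀ κ t₁ : ℝ) (n : ℕ) (t : ℝ) (y : E) : ℝ :=
  m₀ * Real.exp (-l * (t - t₁)) *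
    (-l * (1 - ‖y - c‖ ^ 2 / knssRad r₀ κ t₁ t ^ 2) ^ (n + 2) +
      (n + 2) * (1 - ‖y - c‖ ^ 2 / knssRad r₀ κ t₁ t ^ 2) ^ (n + 1) *
        (2 * κ * ‖y - c‖ ^ 2 / knssRad r₀ κ t₁ t ^ 3))

/-- `P'(σ) = −(m(n+2)/ρ²)(1 − σ/ρ²)^(n+1)` for `P = knssProfile m ρ n`. [folklore] -/
theorem hasDerivAt_knssProfile (m ρ : ℝ) (n : ℕ) (σ : ℝ) :
    HasDerivAt (knssProfile m ρ n) (knssProfile₁ m ρ n σ) σ := by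
  have h1 : HasDerivAt (fun σ : ℝ => 1 - σ / ρ ^ 2) (0 - 1 / ρ ^ 2) σ :=
    (hasDerivAt_const σ (1 : ℝ)).sub ((hasDerivAt_id' σ).div_const (ρ ^ 2))
  have h2 := (h1.fun_pow (n + 2)).const_mul m
  have h3 : knssProfile m ρ n = fun σ => m * (1 - σ / ρ ^ 2) ^ (n + 2) := rfl
  rw [h3]
  refine h2.congr_deriv ?_
  have e : n + 2 - 1 = n + 1 := rfl
  rw [e, knssProfile₁]
  push_cast
  ring

/-- `P''(σ) = (m(n+2)(n+1)/ρ⁴)(1 − σ/ρ²)^n` for `P = knssProfile m ρ n`. [folklore] -/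
theorem hasDerivAt_knssProfile₁ (m ρ : ℝ) (n : ℕ) (σ : ℝ) :
    HasDerivAt (knssProfile₁ m ρ n) (knssProfile₂ m ρ n σ) σ := by
  have h1 : HasDerivAt (fun σ : ℝ => 1 - σ / ρ ^ 2) (0 - 1 / ρ ^ 2) σ :=
    (hasDerivAt_const σ (1 : ℝ)).sub ((hasDerivAt_id' σ).div_const (ρ ^ 2))
  have h2 := (h1.fun_pow (n + 1)).const_mul (-(m * (n + 2) / ρ ^ 2))
  have h3 : knssProfile₁ m ρ n = fun σ => -(m * (n + 2) / ρ ^ 2) * (1 - σ / ρ ^ 2) ^ (n + 1) :=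
    rfl
  rw [h3]
  refine h2.congr_deriv ?_
  have e : n + 1 - 1 = n := rfl
  rw [e, knssProfile₂]
  push_cast
  ring

omit [InnerProductSpace ℝ E] in
/-- The barrier is a translate of the radial function `knssRadial`. [folklore] -/
theorem knssBarrier_eq_comp (c : E) (m₀ l r₀ κ t₁ : ℝ) (n : ℕ) (t : ℝ) :
    knssBarrier c m₀ l r₀ κ t₁ n t = fun y =>
      knssRadial (m₀ * Real.exp (-l * (t - t₁))) (knssRad r₀ κ t₁ t) n (-c + y) := by
  funext y
  simp only [knssBarrier, knssRadial, neg_add_eq_sub]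

/-- Each time slice of the barrier is smooth. [folklore] -/
theorem contDiff_knssBarrier (c : E) (m₀ l r₀ κ t₁ : ℝ) (n : ℕ) (t : ℝ) {N : ℕ∞} :
    ContDiff ℝ N (knssBarrier c m₀ l r₀ κ t₁ n t) := by
  unfold knssBarrier knssProfile
  have h : ContDiff ℝ N fun y : E => ‖y - c‖ ^ 2 := (contDiff_id.sub contDiff_const).norm_sq ℝ
  exact contDiff_const.mul ((contDiff_const.sub (h.div_const _)).pow _)

/-- Gradient of the barrier: `Dφ(t, ·)(y) = 2 P'(‖y − c‖²) ⟨y − c, ·⟩`. [folklore] -/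
theorem hasFDerivAt_knssBarrier (c : E) (m₀ l r₀ κ t₁ : ℝ) (n : ℕ) (t : ℝ) (y : E) :
    HasFDerivAt (knssBarrier c m₀ l r₀ κ t₁ n t)
      ((2 * knssProfile₁ (m₀ * Real.exp (-l * (t - t₁))) (knssRad r₀ κ t₁ t) n
        (‖y - c‖ ^ 2)) • (innerSL ℝ (y - c) : E →L[ℝ] ℝ)) y := by
  have h1 := hasFDerivAt_comp_norm_sq (z := y - c)
    (hasDerivAt_knssProfile (m₀ * Real.exp (-l * (t - t₁))) (knssRad r₀ κ t₁ t) n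
      (‖y - c‖ ^ 2))
  have h2 : HasFDerivAt (fun y : E => y - c) (ContinuousLinearMap.id ℝ E) y :=
    (hasFDerivAt_id y).sub_const c
  have h3 := h1.comp y h2
  rw [ContinuousLinearMap.comp_id] at h3
  exact h3

/-- Norm of the gradient of the barrier. [folklore] -/
theorem norm_fderiv_knssBarrier (c : E) (m₀ l r₀ κ t₁ : ℝ) (n : ℕ) (t : ℝ) (y : E) :
    ‖fderiv ℝ (knssBarrier c m₀ l r₀ κ t₁ n t) y‖ =
      2 * |knssProfile₁ (m₀ * Real.exp (-l * (t - t₁))) (knssRad r₀ κ t₁ t) n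
        (‖y - c‖ ^ 2)| * ‖y - c‖ := by
  rw [(hasFDerivAt_knssBarrier c m₀ l r₀ κ t₁ n t y).fderiv, norm_smul, innerSL_apply_norm,
    Real.norm_eq_abs, abs_mul, abs_two]

/-- Laplacian of the radial function: `Δ(P(‖·‖²))(z) = 4 P''(‖z‖²) ‖z‖² + 2 d P'(‖z‖²)`.
[folklore] -/
theorem laplacian_knssRadial [FiniteDimensional ℝ E] (m ρ : ℝ) (n : ℕ) (z : E) :
    (Δ (knssRadial (E := E) m ρ n)) z =
      4 * knssProfile₂ m ρ n (‖z‖ ^ 2) * ‖z‖ ^ 2 +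
        2 * (Module.finrank ℝ E) * knssProfile₁ m ρ n (‖z‖ ^ 2) :=
  laplacian_comp_norm_sq (U := univ) isOpen_univ (fun σ _ => hasDerivAt_knssProfile m ρ n σ)
    (mem_univ _) (hasDerivAt_knssProfile₁ m ρ n (‖z‖ ^ 2))

/-- Laplacian of the barrier: `Δφ(t, ·)(y) = 4 P''(σ) σ + 2 d P'(σ)`, `σ = ‖y − c‖²`,
`d = dim E`. [folklore] -/
theorem laplacian_knssBarrier [FiniteDimensional ℝ E] (c : E) (m₀ l r₀ κ t₁ : ℝ) (n : ℕ)
    (t : ℝ) (y : E) :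
    (Δ (knssBarrier c m₀ l r₀ κ t₁ n t)) y =
      4 * knssProfile₂ (m₀ * Real.exp (-l * (t - t₁))) (knssRad r₀ κ t₁ t) n (‖y - c‖ ^ 2) *
          ‖y - c‖ ^ 2 +
        2 * (Module.finrank ℝ E) *
          knssProfile₁ (m₀ * Real.exp (-l * (t - t₁))) (knssRad r₀ κ t₁ t) n (‖y - c‖ ^ 2) := by
  rw [knssBarrier_eq_comp, laplacian_comp_const_add, laplacian_knssRadial, neg_add_eq_sub]

/-- `ρ'(t) = κ`. [folklore] -/
theorem hasDerivAt_knssRad (r₀ κ t₁ t : ℝ) : HasDerivAt (knssRad r₀ κ t₁) κ t := by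
  have h : HasDerivAt (fun s => r₀ + κ * (s - t₁)) (0 + κ * 1) t :=
    (hasDerivAt_const t r₀).add (((hasDerivAt_id' t).sub_const t₁).const_mul κ)
  have e : knssRad r₀ κ t₁ = fun s => r₀ + κ * (s - t₁) := rfl
  rw [e]
  refine h.congr_deriv ?_
  ring

omit [InnerProductSpace ℝ E] in
/-- Time derivative of the barrier (where the radius is nonzero). [folklore] -/
theorem hasDerivAt_knssBarrier_time (c : E) (m₀ l r₀ κ t₁ : ℝ) (n : ℕ) {t : ℝ} (y : E)
    (hρ : knssRad r₀ κ t₁ t ≠ 0) :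
    HasDerivAt (fun s => knssBarrier c m₀ l r₀ κ t₁ n s y) (knssBarrierDt c m₀ l r₀ κ t₁ n t y)
      t := by
  -- the exponential factor
  have he : HasDerivAt (fun s => m₀ * Real.exp (-l * (s - t₁)))
      (m₀ * (Real.exp (-l * (t - t₁)) * (-l * 1))) t :=
    (((hasDerivAt_id' t).sub_const t₁).const_mul (-l)).exp.const_mul m₀
  -- the radius and the bracket
  have hρ2 : HasDerivAt (fun s => knssRad r₀ κ t₁ s ^ 2)
      ((2 : ℕ) * knssRad r₀ κ t₁ t ^ (2 - 1) * κ) t := (hasDerivAt_knssRad r₀ κ t₁ t).fun_pow 2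
  have hw : HasDerivAt (fun s => 1 - ‖y - c‖ ^ 2 / knssRad r₀ κ t₁ s ^ 2)
      (0 - (0 * knssRad r₀ κ t₁ t ^ 2 - ‖y - c‖ ^ 2 * ((2 : ℕ) * knssRad r₀ κ t₁ t ^ (2 - 1) * κ)) /
        (knssRad r₀ κ t₁ t ^ 2) ^ 2) t :=
    (hasDerivAt_const t (1 : ℝ)).sub ((hasDerivAt_const t _).div hρ2 (pow_ne_zero 2 hρ))
  have h := he.mul (hw.fun_pow (n + 2))
  have heq : (fun s => knssBarrier c m₀ l r₀ κ t₁ n s y) = fun s =>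
      m₀ * Real.exp (-l * (s - t₁)) * (1 - ‖y - c‖ ^ 2 / knssRad r₀ κ t₁ s ^ 2) ^ (n + 2) := rfl
  rw [heq]
  refine h.congr_deriv ?_
  have e1 : n + 2 - 1 = n + 1 := rfl
  have e2 : (2 : ℕ) - 1 = 1 := rfl
  rw [e1, e2, knssBarrierDt]
  push_cast
  field_simp
  ring

/-- Lower bound for the radius after time `t₁` (nonnegative expansion rate). [folklore] -/
theorem le_knssRad {r₀ κ t₁ t : ℝ} (hκ : 0 ≤ κ) (ht : t₁ ≤ t) : r₀ ≤ knssRad r₀ κ t₁ t := by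
  unfold knssRad
  nlinarith

/-- The radius is monotone in time (nonnegative expansion rate). [folklore] -/
theorem knssRad_mono {r₀ κ t₁ s t : ℝ} (hκ : 0 ≤ κ) (hst : s ≤ t) :
    knssRad r₀ κ t₁ s ≤ knssRad r₀ κ t₁ t := by
  unfold knssRad
  nlinarith

/-- **The barrier is a subsolution**: with `B = 2κ/r₀ + 2d/r₀² + 2A/r₀`, if `(n + 2) B ≤ l` and
`B ρmax² ≤ 4 (n + 1)`, then `φ_t − Δφ + A ‖∇φ‖ ≤ 0` at every `(t, y)` with `t ≥ t₁`,
`ρ(t) ≤ ρmax` and `‖y − c‖ ≤ ρ(t)`. [folklore] -/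
theorem knssBarrier_subsolution [FiniteDimensional ℝ E] {c : E} {m₀ l r₀ κ t₁ A ρmax : ℝ}
    {n : ℕ} (hA : 0 ≤ A) (hκ : 0 ≤ κ) (hr₀ : 0 < r₀) (hm₀ : 0 ≤ m₀)
    (hl : (n + 2) * (2 * κ / r₀ + 2 * Module.finrank ℝ E / r₀ ^ 2 + 2 * A / r₀) ≤ l)
    (hn : (2 * κ / r₀ + 2 * Module.finrank ℝ E / r₀ ^ 2 + 2 * A / r₀) * ρmax ^ 2 ≤ 4 * (n + 1))
    {t : ℝ} (ht : t₁ ≤ t) (hρmax : knssRad r₀ κ t₁ t ≤ ρmax) {y : E}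
    (hy : ‖y - c‖ ≤ knssRad r₀ κ t₁ t) :
    knssBarrierDt c m₀ l r₀ κ t₁ n t y - (Δ (knssBarrier c m₀ l r₀ κ t₁ n t)) y +
        A * ‖fderiv ℝ (knssBarrier c m₀ l r₀ κ t₁ n t) y‖ ≤ 0 := by
  have halg := knssBarrier_bracket_nonpos (d := (Module.finrank ℝ E : ℝ)) (l := l) n hA hκ hr₀
    (by positivity) hl hn (le_knssRad hκ ht) hρmax (norm_nonneg (y - c)) hy
  -- generalize the time-dependent quantities
  rw [laplacian_knssBarrier, norm_fderiv_knssBarrier, knssBarrierDt]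
  generalize hm : m₀ * Real.exp (-l * (t - t₁)) = m at halg ⊢
  generalize hρ : knssRad r₀ κ t₁ t = ρ at halg hy ⊢
  generalize hz : ‖y - c‖ = z at halg hy ⊢
  have hm0 : 0 ≤ m := by rw [← hm]; exact mul_nonneg hm₀ (Real.exp_pos _).le
  have hρ0 : 0 < ρ := by rw [← hρ]; exact hr₀.trans_le (le_knssRad hκ ht)
  have hz0 : 0 ≤ z := by rw [← hz]; exact norm_nonneg _
  have hu0 : 0 ≤ 1 - z ^ 2 / ρ ^ 2 := by
    have : z ^ 2 / ρ ^ 2 ≤ 1 := by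
      rw [div_le_one (by positivity)]
      exact pow_le_pow_left₀ hz0 hy 2
    linarith
  have hP1 : |knssProfile₁ m ρ n (z ^ 2)| = m * (n + 2) / ρ ^ 2 * (1 - z ^ 2 / ρ ^ 2) ^ (n + 1) := by
    rw [knssProfile₁, neg_mul, abs_neg, abs_of_nonneg (by positivity)]
  rw [hP1, knssProfile₁, knssProfile₂]
  have hfac : m * (-l * (1 - z ^ 2 / ρ ^ 2) ^ (n + 2) +
        (n + 2) * (1 - z ^ 2 / ρ ^ 2) ^ (n + 1) * (2 * κ * z ^ 2 / ρ ^ 3)) -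
      (4 * (m * (n + 2) * (n + 1) / ρ ^ 4 * (1 - z ^ 2 / ρ ^ 2) ^ n) * z ^ 2 +
        2 * (Module.finrank ℝ E : ℝ) *
          (-(m * (n + 2) / ρ ^ 2) * (1 - z ^ 2 / ρ ^ 2) ^ (n + 1))) +
      A * (2 * (m * (n + 2) / ρ ^ 2 * (1 - z ^ 2 / ρ ^ 2) ^ (n + 1)) * z) =
      m * (1 - z ^ 2 / ρ ^ 2) ^ n *
        (-l * (1 - z ^ 2 / ρ ^ 2) ^ 2 +
          (n + 2) * (1 - z ^ 2 / ρ ^ 2) *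
            (2 * κ * z ^ 2 / ρ ^ 3 + 2 * (Module.finrank ℝ E : ℝ) / ρ ^ 2 + 2 * A * z / ρ ^ 2) -
          4 * (n + 2) * (n + 1) * z ^ 2 / ρ ^ 4) := by
    ring
  rw [hfac]
  exact mul_nonpos_of_nonneg_of_nonpos (by positivity) halg

end Barrier

end Literature.Analysis.FluidPDE

end
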